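import Literature.MathematicalPhysics.QuantumFieldTheory.Balaban1983to89.B1Eq324BenfattoKernelSect5ClassBasicLemma
import Literature.MathematicalPhysics.QuantumFieldTheory.Balaban1983to89.B1Eq324BenfattoClassCollar
import Literature.MathematicalPhysics.QuantumFieldTheory.Balaban1983to89.B1Eq324BenfattoKernelCondField
import Literature.MathematicalPhysics.QuantumFieldTheory.Balaban1983to89.B1Eq324BenfattoClassEntryRows
import HarnessLib

/-!
# `Balaban1983to89.B1Eq324BenfattoKernelSect5ClassBasicLemmaExplicit` — [BenfattoEtAl1978] Lemma p. 152 (4.5)–(4.7) and p. 159 «b* can be chosen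
# = max{10⁴, γ⁻³b̄}» FOR THE CLASS of [Balaban1985BackgroundPropagators] Sect. E: the knit `…ClassBasicLemma.classBasicLemma_signed'` with its
# threshold `b*` DISPLAYED AS A FORMULA in the class constants `(γ_A, J_c, θ, V, M, M₂, V₄, d)` instead of hidden under `∃ b*`, and the NO-PAD knit
# form for `μ_K` (`J ⊆ Λ` only) through seat n08-d's independent collar, PROVED

statement-level skeleton of published theorems with citation tags; proofs where landed; nothing here is a claim about the
Yang–Mills mass gap

WHY THIS MODULE (cell `pub-ymgap`, seat `dag-n08-c` gen 33, CLAIM-24; node N08 [Balaban1985UV3]; the [BenfattoEtAl1978] source chain behind the (α)-row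
`h324`).  The (α)-socket serves the row `h324` at EVERY run step through the knit form of the class sandwich under ONE displayed window
`hbw : b* < b₀` — the class road's threshold against the record's `b₀` (seat n08-w4, `…RowClassSocketAllSteps.exists_h324Row_freeLetter_of_classSandwich_allSteps_of_forall_gt_ae`,
LOCATED «ALL STEPS» I.37547: «what stays DISPLAYED is the threshold window»).  In `classBasicLemma_signed(')` (seat n08-c gen 32, p634629 / p635508) the
threshold is CHOSEN explicitly in the proof — `b* := max(b*_pack(γ), 16·M₂V₄/(θ(γ_A − J_c)) + 1)` at the contraction `γ := min 1 ((γ_A − J_c)/(4(VM + M₂V₄) + 1))`,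
`b*_pack(γ) = 6·2^d(d+1)!·(4/γ^{2d})^{d+1} + 10(d+1)(⌈1/(2θ) + √(J_c/γ_A)/θ⌉ + 1) + 2/(γ^{d+1}√γ_A) + γ^{−(d+1)} + 1` (seat n08-b's packs
`lowerpack_class'` / `upperpack_class`, whose `b*` is a free parameter above that formula) — but EXPORTED as `∃ b*`, so no consumer can compare it with
`b₀`.  This file re-runs the v1.1 proof with the formula in the statement: the window becomes a decidable inequality between the class constants (N06's
in-edge data at [Balaban1985UV3]'s objects) and the record's `b₀`.  Print: p. 159 «b* can be chosen = max{10⁴, γ⁻³b̄}» — an explicit number there too.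

DICTIONARY / SHAPE.  Exactly `classBasicLemma_signed'` (binder for binder, both halves, signs `0 ≤ S ∧ 0 ≤ ρ₁ ∧ 0 ≤ ρ₂ ∧ 0 < ρ₃ ∧ 0 ≤ ρ₄`) with the
leading `∃ bstar, ∀ t D ϰ …` replaced by `∀ t D ϰ …`, `bstar < b` replaced by `B*(γ_A, J_c, θ, V, M, M₂, V₄, d) < b` (the formula spelled out; no
definition is introduced), and the extra conjunct `ρ₃ ≤ D + 2d` exported.

WHAT IS PROVED (theorems only; no definition, no instance, no notation, no named fact, no `sorry`; axioms standard).
* ★★★ `classBasicLemma_signed_explicit` — the class Basic Lemma, signed shape, at the EXPLICIT threshold; proof = v1.1's (§1 rows of `…ClassBasicLemma`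
  `gamma_rows` / `far_term_le_quarter` / `pad_of_sq_pad` / `far_of_far`, seat n08-b's `lowerpack_class'` / `upperpack_class` /
  `ineq47_class_of_pack` / `ineq46_class_of_pack` BY NAME).
* `classBasicLemma_signed'_le` — v1.1's `∃`-shape WITH the bound recorded: `∃ bstar ≤ B*(…), …` (one line from the explicit form).
* §2 ★★★ `classBasicLemma_noPad_explicit` — NO WINDOW PAD: the two `C = ∅` halves ((4.7) and (4.6) at `C = ∅`) for `μ_K` with `J ⊆ Λ` only, at the explicit
  threshold `max(B*(…, max M γ_A, max M₂ γ_A, …), 2/√γ_A, (2(D+2d)/γ_A)²)`, constants `(S + 4·8^d, ρ₁, …, ρ₄)`, the growth rows taken Λ-uniformly — seat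
  n08-d's independent collar (`…ClassCollar`) run in `b`-currency; this is the `hknit` input of seat n08-w4's all-steps socket, letter for letter.
* §3 ★★★ `classBasicLemma_kernel_noPad` — §2 with the growth rows discharged on the lattice (`…ClassEntryRows`): the member carries only `hK`, `Λ ≠ ∅`,
  symmetry, `γ_A`-coercivity and the rows `J_c, M, M₂` (the binder list of `…KernelEq324.eq324_kernel_noPad`), threshold a formula in `(γ_A, J_c, θ, M, M₂, d, D)`.

HONEST SCOPE / NOT HERE.  Quantifier bookkeeping only (no estimate re-proved); whether the record's `b₀` exceeds `B*` at [Balaban1985UV3]'s data is the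
IDENT's / the planners' question (N06 supplies `γ_A, J_c, θ, …`), NOT answered here; the class, its constants and normalisations (`γ_A ≥ 2`, the window pad)
are OURS; nothing of [Balaban1985UV3] / [Balaban1985UV2] is asserted; `PrintedUV3V` / row `h324c` NOT discharged; N08 NOT discharged; count-neutral; nothing
about d = 4, the continuum, OS axioms, a mass gap or the Clay problem.
-/

open MeasureTheory Finset
open scoped BigOperators

namespace Literature.MathematicalPhysics.QuantumFieldTheory.Balaban1983to89.B1Eq324BenfattoKernelSect5ClassBasicLemmaExplicit

open _root_.MeasureTheory
open Literature.MathematicalPhysics.QuantumFieldTheory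
open Literature.MathematicalPhysics.QuantumFieldTheory.Balaban1983to89.B1Eq324BenfattoLemma
open Literature.MathematicalPhysics.QuantumFieldTheory.Balaban1983to89.B1Eq324BenfattoSect5Eq511 (s1Const)
open Literature.MathematicalPhysics.QuantumFieldTheory.Balaban1983to89.B1Eq324BenfattoSpecialisation (coefSup_nonneg)
open Literature.MathematicalPhysics.QuantumFieldTheory.Balaban1983to89.B1Eq324BenfattoSect5ErrTermLedger (errTerm_mono)
open Literature.MathematicalPhysics.QuantumFieldTheory.Balaban1983to89.B1Eq324BenfattoKernelSect5LedgerDischargeLower (lowerpack_class')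
open Literature.MathematicalPhysics.QuantumFieldTheory.Balaban1983to89.B1Eq324BenfattoKernelSect5LedgerDischargeUpper (upperpack_class)
open Literature.MathematicalPhysics.QuantumFieldTheory.Balaban1983to89.B1Eq324BenfattoKernelSect5Ineq47Class (ineq47_class_of_pack)
open Literature.MathematicalPhysics.QuantumFieldTheory.Balaban1983to89.B1Eq324BenfattoKernelSect5Ineq46Class (ineq46_class_of_pack)
open Literature.MathematicalPhysics.QuantumFieldTheory.Balaban1983to89.B1Eq324BenfattoKernelSect5ClassBasicLemma
  (pad_of_sq_pad far_of_far gamma_rows far_term_le_quarter)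
open Literature.MathematicalPhysics.QuantumFieldTheory.Balaban1983to89.B1Eq324BenfattoKernelCondField (condFieldK_empty)
open Literature.MathematicalPhysics.QuantumFieldTheory.Balaban1983to89.B1Eq324BenfattoKernelOfPrecision (isPosSemidefKernel_kernel)
open Literature.MathematicalPhysics.QuantumFieldTheory.Balaban1983to89.B1Eq324BenfattoClassAppendixC (posDef_of_coercive)
open Literature.MathematicalPhysics.QuantumFieldTheory.Balaban1983to89.B1Eq324BenfattoClassCollar
  (symm_collar coercive_collar row_collar_le sandwich_of_collarMember_sandwich)
open Literature.MathematicalPhysics.QuantumFieldTheory.Balaban1983to89.B1Eq324BenfattoClassEntryRows (classRow_V_le classRow_V₂_le classRow_V₄_le)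

variable {d : ℕ}

/-- ★★★ **THE LEMMA OF p. 152 FOR THE CLASS, SIGNED SHAPE, AT THE EXPLICIT THRESHOLD** `B*(γ_A, J_c, θ, V, M, M₂, V₄, d) =
max(6·2^d(d+1)!·(4/γ^{2d})^{d+1} + 10(d+1)(⌈1/(2θ) + √(J_c/γ_A)/θ⌉ + 1) + 2/(γ^{d+1}√γ_A) + γ^{−(d+1)} + 1, 16·M₂V₄/(θ(γ_A−J_c)) + 1)`,
`γ = min 1 ((γ_A − J_c)/(4(VM + M₂V₄) + 1))`: for `d ≥ 1`, class constants `γ_A ≥ 2`, `0 ≤ J_c < γ_A`, `θ > 0`, `V, M, V₂, M₂, V₄ ≥ 0`, every `(t, D, ϰ > 0)`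
has ONE signed package `(S ≥ 0, ρ₁ ≥ 0, ρ₂ ≥ 0, 0 < ρ₃ ≤ D + 2d, ρ₄ ≥ 0)` (the bound on `ρ₃` — the packs' floor `D + 2d` — is what a
no-padding transfer through seat n08-d's collar needs to place its threshold `√b ≥ 2ρ₃/γ_A`) such that every member `(Λ, A, K)` with the rows, every `s`, every `b > B*`, every `I ⊇ J`
(`I ≠ ∅`, `J` padded in `Λ` at `b²`), every `𝔄` satisfy [(4.6) for every `C ⊆ Λ` far from `J`, every `z̄`] ∧ [(4.7)] — the statement of
`…ClassBasicLemma.classBasicLemma_signed'` with its `∃ b*` opened.  [cite: BenfattoEtAl1978, Lemma p.152 (4.5)–(4.7), Remark 1; «b*» p.159;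
Balaban1985BackgroundPropagators, (1.16)–(1.18) p.180, Sect. E p.428 (class form; ours)] -/
theorem classBasicLemma_signed_explicit (hd : 0 < d) {γA Jc θ V M V₂ M₂ V₄ : ℝ} (hγA2 : 2 ≤ γA) (hJc0 : 0 ≤ Jc) (hJcγ : Jc < γA) (hθ : 0 < θ)
    (hV0 : 0 ≤ V) (hM0 : 0 ≤ M) (hV₂0 : 0 ≤ V₂) (hM₂0 : 0 ≤ M₂) (hV₄0 : 0 ≤ V₄) :
    ∀ (t D : ℕ) (κ : ℝ), 0 < κ →
      ∃ S ρ₁ ρ₂ ρ₃ ρ₄ : ℝ, 0 ≤ S ∧ 0 ≤ ρ₁ ∧ 0 ≤ ρ₂ ∧ 0 < ρ₃ ∧ ρ₃ ≤ (D : ℝ) + 2 * d ∧ 0 ≤ ρ₄ ∧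
        ∀ {Λ : Finset (B1Eq324BenfattoLemma.Site d)} {A : Matrix Λ Λ ℝ} {K : B1Eq324BenfattoLemma.Site d → B1Eq324BenfattoLemma.Site d → ℝ},
          (∀ x y, K x y = if h : x ∈ Λ ∧ y ∈ Λ then (A⁻¹ : Matrix Λ Λ ℝ) ⟨x, h.1⟩ ⟨y, h.2⟩ else 0) → Λ.Nonempty →
          (∀ e e', A e e' = A e' e) → (∀ x : Λ → ℝ, γA * ∑ e, x e ^ 2 ≤ ∑ e, ∑ e', A e e' * x e * x e') →
          (∀ e : Λ, ∑ e' : Λ, |A e e'| * (Real.cosh (θ * Real.sqrt (∑ j, ((((e : B1Eq324BenfattoLemma.Site d) j : ℝ) - ((e' : B1Eq324BenfattoLemma.Site d) j : ℝ))) ^ 2)) - 1) ≤ Jc) →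
          (∀ e : Λ, ∑ e' : Λ, Real.exp (-(θ * Real.sqrt (∑ j, ((((e : B1Eq324BenfattoLemma.Site d) j : ℝ) - ((e' : B1Eq324BenfattoLemma.Site d) j : ℝ))) ^ 2))) *
            (1 + Real.sqrt (∑ j, ((((e : B1Eq324BenfattoLemma.Site d) j : ℝ) - ((e' : B1Eq324BenfattoLemma.Site d) j : ℝ))) ^ 2)) ≤ V) →
          (∀ e : Λ, ∑ e' : Λ, |A e e'| * (1 + Real.sqrt (∑ j, ((((e : B1Eq324BenfattoLemma.Site d) j : ℝ) - ((e' : B1Eq324BenfattoLemma.Site d) j : ℝ))) ^ 2)) ≤ M) →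
          (∀ e : Λ, ∑ e' : Λ, Real.exp (-(θ / 2 * Real.sqrt (∑ j, ((((e : B1Eq324BenfattoLemma.Site d) j : ℝ) - ((e' : B1Eq324BenfattoLemma.Site d) j : ℝ))) ^ 2))) ≤ V₂) →
          (∀ e : Λ, ∑ e' : Λ, |A e e'| * Real.exp (θ / 2 * Real.sqrt (∑ j, ((((e : B1Eq324BenfattoLemma.Site d) j : ℝ) - ((e' : B1Eq324BenfattoLemma.Site d) j : ℝ))) ^ 2)) ≤ M₂) →
          (∀ e : Λ, ∑ e' : Λ, Real.exp (-(θ / 4 * Real.sqrt (∑ j, ((((e : B1Eq324BenfattoLemma.Site d) j : ℝ) - ((e' : B1Eq324BenfattoLemma.Site d) j : ℝ))) ^ 2))) *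
            (1 + Real.sqrt (∑ j, ((((e : B1Eq324BenfattoLemma.Site d) j : ℝ) - ((e' : B1Eq324BenfattoLemma.Site d) j : ℝ))) ^ 2)) ≤ V₄) →
          ∀ (s : ℕ) (b : ℝ),
            max (6 * 2 ^ d * ((d + 1).factorial : ℝ) * (4 / ((min 1 ((γA - Jc) / (4 * (V * M + M₂ * V₄) + 1))) ^ d) ^ 2) ^ (d + 1)
                + 10 * (d + 1) * ((⌈1 / (2 * θ) + Real.sqrt (Jc / γA) / θ⌉₊ + 1 : ℕ) : ℝ)
                + 2 / ((min 1 ((γA - Jc) / (4 * (V * M + M₂ * V₄) + 1))) ^ (d + 1) * Real.sqrt γA)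
                + ((min 1 ((γA - Jc) / (4 * (V * M + M₂ * V₄) + 1))) ^ (d + 1))⁻¹ + 1)
              (16 * (M₂ * V₄) / (θ * (γA - Jc)) + 1) < b →
            ∀ (I J : Finset (B1Eq324BenfattoLemma.Site d)), I.Nonempty → J ⊆ I →
            (∀ x ∈ J, ∀ z : B1Eq324BenfattoLemma.Site d, (∀ i, ((|z i - x i| : ℤ) : ℝ) ≤ b ^ 2) → z ∈ Λ) → ∀ a : Coef d,
            (∀ (C : Finset (B1Eq324BenfattoLemma.Site d)) (zbar : B1Eq324BenfattoLemma.Site d → ℝ), C ⊆ Λ →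
                (∀ c ∈ C, ∀ x ∈ J, b ^ 3 + Real.sqrt d * (b ^ 2 + 1) ≤ Real.sqrt (∑ j, (((x j : ℝ) - (c j : ℝ))) ^ 2)) →
                ∫ z, cutoffBoltzmann (hamiltonian s D κ a J) I b z ∂((gaussianFieldOfKernel (condCov K C)).map
                    fun (ζ' : B1Eq324BenfattoLemma.Site d → ℝ) (x : B1Eq324BenfattoLemma.Site d) => condMean K C zbar x + ζ' x) ≤
                  Real.exp (cumulantSum (gaussianFieldOfKernel K) (hamiltonian s D κ a J) t +
                    (I.card : ℝ) * errTerm S ρ₁ ρ₂ ρ₃ ρ₄ (coefSup s D a J) b t)) ∧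
            Real.exp (cumulantSum (gaussianFieldOfKernel K) (hamiltonian s D κ a J) t -
                  (I.card : ℝ) * errTerm S ρ₁ ρ₂ ρ₃ ρ₄ (coefSup s D a J) b t) ≤
                ∫ z, cutoffBoltzmann (hamiltonian s D κ a J) I b z ∂gaussianFieldOfKernel K := by
  classical
  intro t D κ hκ
  -- the contraction, fixed from the class constants
  obtain ⟨hγ0, hγ1, hsmallγ, hquarter⟩ := gamma_rows hJcγ hV0 hM0 hM₂0 hV₄0
  set γ : ℝ := min 1 ((γA - Jc) / (4 * (V * M + M₂ * V₄) + 1)) with hγdef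
  have hγA0 : 0 < γA := by linarith
  have hhalf : 1 / γA ≤ 1 / 2 := one_div_le_one_div_of_le two_pos hγA2
  -- the threshold is displayed in the statement: the packs' `b*` at this `γ`, and the far threshold of the upper centre row
  -- the exponents at the packs' floors (the upper `ρ₄`-floor dominates the lower one)
  have hρ₄' : 8 * s1Const D D d κ * 1 ^ D * 2 ^ d + 1 ≤ 8 * s1Const D D d κ * (γ ^ (d + 1))⁻¹ ^ D * 2 ^ d + 1 := by
    have hS : 0 ≤ s1Const D D d κ := B1Eq324BenfattoSect5ErrTermLedger.s1Const_nonneg D D d hκ.le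
    have h1 : (1 : ℝ) ^ D ≤ (γ ^ (d + 1))⁻¹ ^ D := by
      rw [one_pow]
      exact one_le_pow₀ (one_le_inv_iff₀.mpr ⟨pow_pos hγ0 _, pow_le_one₀ hγ0.le hγ1⟩)
    have h2 : 0 ≤ 8 * s1Const D D d κ := by positivity
    nlinarith [mul_le_mul_of_nonneg_left h1 h2, pow_nonneg (zero_le_two (α := ℝ)) d]
  obtain ⟨S₇, δ₇, hS₇, hδ₇, hδle₇, hres₇, hall₇⟩ := lowerpack_class' hd hγA0 hJc0 hJcγ hθ hV0 hM0 hV₂0 hM₂0 hV₄0 hγ0 hγ1 t D hκ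
    (ρ₁ := (D : ℝ) + 2 * d) (ρ₂ := 0) (ρ₃ := (D : ℝ) + 2 * d) le_rfl le_rfl le_rfl hρ₄' (le_max_left _ (16 * (M₂ * V₄) / (θ * (γA - Jc)) + 1))
  obtain ⟨S₆, δ₆, hS₆, hδ₆, hδle₆, hres₆, hall₆⟩ := upperpack_class hd hγA0 hJc0 hJcγ hθ hV0 hM0 hV₂0 hM₂0 hV₄0 hγ0 hγ1 t D hκ
    (ρ₁ := (D : ℝ) + 2 * d) (ρ₂ := 0) (ρ₃ := (D : ℝ) + 2 * d) le_rfl le_rfl le_rfl le_rfl (le_max_left _ (16 * (M₂ * V₄) / (θ * (γA - Jc)) + 1))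
  have hρ₄0 : (0 : ℝ) ≤ 8 * s1Const D D d κ * (γ ^ (d + 1))⁻¹ ^ D * 2 ^ d + 1 :=
    add_nonneg (mul_nonneg (mul_nonneg (mul_nonneg (by norm_num) (B1Eq324BenfattoSect5ErrTermLedger.s1Const_nonneg D D d hκ.le))
      (pow_nonneg (inv_nonneg.mpr (pow_nonneg hγ0.le _)) _)) (pow_nonneg zero_le_two _)) zero_le_one
  refine ⟨max S₇ S₆, (D : ℝ) + 2 * d, 0, (D : ℝ) + 2 * d, 8 * s1Const D D d κ * (γ ^ (d + 1))⁻¹ ^ D * 2 ^ d + 1,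
    le_max_of_le_left hS₇, by positivity, le_rfl, by positivity, le_rfl, hρ₄0, ?_⟩
  intro Λ A K hK hΛ hAs hγA hJc hV hM hV₂ hM₂ hV₄ s b hb I J hI hJI hpad a
  have hbU : 16 * (M₂ * V₄) / (θ * (γA - Jc)) + 1 ≤ b := (le_max_right _ _).trans hb.le
  have hb0 : 0 ≤ b := by
    have : 0 ≤ 16 * (M₂ * V₄) / (θ * (γA - Jc)) := by
      have hg : 0 < γA - Jc := by linarith
      positivity
    linarith
  have hA0 : 0 ≤ coefSup s D a J := coefSup_nonneg s D a J
  have hI1 : (1 : ℝ) ≤ (I.card : ℝ) := by exact_mod_cast Finset.card_pos.mpr hI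
  have hI0 : (0 : ℝ) ≤ (I.card : ℝ) := Nat.cast_nonneg _
  have hmono₇ := mul_le_mul_of_nonneg_left
    (errTerm_mono (ρ₁ := (D : ℝ) + 2 * d) (ρ₂ := 0) (ρ₃ := (D : ℝ) + 2 * d)
      (ρ₄ := 8 * s1Const D D d κ * (γ ^ (d + 1))⁻¹ ^ D * 2 ^ d + 1) (t := t) (le_max_left S₇ S₆) hA0 hb0) hI0
  have hmono₆ := mul_le_mul_of_nonneg_left
    (errTerm_mono (ρ₁ := (D : ℝ) + 2 * d) (ρ₂ := 0) (ρ₃ := (D : ℝ) + 2 * d)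
      (ρ₄ := 8 * s1Const D D d κ * (γ ^ (d + 1))⁻¹ ^ D * 2 ^ d + 1) (t := t) (le_max_right S₇ S₆) hA0 hb0) hI0
  constructor
  · -- (4.6): the upper pack at `b`, its pavement, the per-member upper theorem, then `S₄₆ ≤ S`
    intro C zbar hC0 hCfar
    obtain ⟨L, w, v, hLdef, hwv, hL2, hfit, hv, hw, hb1, hsmall, hguard, hW1, hW2, hwv3, hclause⟩ := hall₆ b hb
    have hsmallU : M₂ * V₄ / (γA - Jc) * (γ + Real.exp (-(θ / 4 * b ^ 3))) ≤ 1 / 2 := by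
      rw [mul_add]
      linarith [far_term_le_quarter hJcγ hθ hM₂0 hV₄0 hbU]
    have h46 := ineq46_class_of_pack hK hΛ hAs hγA0 hγA hθ hJc hJcγ hV hM hV₂ hM₂ hV₄ hJc0 hV0 hM0 hV₂0 hM₂0 hV₄0 hhalf hκ hγ0 hγ1
      hsmallU hδ₆ hδle₆ hres₆ t hL2 hfit hv hw hb1 hsmall hguard hW1 hW2 hJI a rfl (pad_of_sq_pad hLdef hpad) hC0
      (far_of_far hLdef hCfar) zbar (fun n hn => hclause s n (I.card : ℝ) (coefSup s D a J) hn hI1 hA0)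
    exact h46.trans (Real.exp_le_exp.mpr (by linarith))
  · -- (4.7): the lower pack at `b`, its pavement, the per-member lower theorem, then `S₄₇ ≤ S`
    obtain ⟨L, w, v, hLdef, hwv, hL2, hfit, hv, hw, hgb1, hsmall, hguard, hW1, hW2, hterm, hclause⟩ := hall₇ b hb
    have h47 := ineq47_class_of_pack hK hΛ hAs hγA0 hγA hθ hJc hJcγ hV hM hV₂ hM₂ hV₄ hJc0 hV0 hM0 hV₂0 hM₂0 hV₄0 hhalf hκ hγ0 hγ1
      hsmallγ hδ₇ hδle₇ hres₇ t hL2 hfit hv hw hgb1 hsmall hguard hW1 hW2 hterm hJI hI a rfl (pad_of_sq_pad hLdef hpad)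
      (fun n hn => hclause s n (I.card : ℝ) (coefSup s D a J) hn hI1 hA0)
    exact le_trans (Real.exp_le_exp.mpr (by linarith)) h47

/-- **v1.1's `∃`-SHAPE WITH THE BOUND RECORDED**: `∃ b* ≤ B*(γ_A, J_c, θ, V, M, M₂, V₄, d)` with the body of `…ClassBasicLemma.classBasicLemma_signed'` — so a
consumer holding the window `B*(…) < b₀` gets `b* < b₀`. [cite: BenfattoEtAl1978, Lemma p.152 (4.5)–(4.7); «b*» p.159 (class form; ours)] -/
theorem classBasicLemma_signed'_le (hd : 0 < d) {γA Jc θ V M V₂ M₂ V₄ : ℝ} (hγA2 : 2 ≤ γA) (hJc0 : 0 ≤ Jc) (hJcγ : Jc < γA) (hθ : 0 < θ)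
    (hV0 : 0 ≤ V) (hM0 : 0 ≤ M) (hV₂0 : 0 ≤ V₂) (hM₂0 : 0 ≤ M₂) (hV₄0 : 0 ≤ V₄) :
    ∃ bstar : ℝ, bstar ≤
      max (6 * 2 ^ d * ((d + 1).factorial : ℝ) * (4 / ((min 1 ((γA - Jc) / (4 * (V * M + M₂ * V₄) + 1))) ^ d) ^ 2) ^ (d + 1)
          + 10 * (d + 1) * ((⌈1 / (2 * θ) + Real.sqrt (Jc / γA) / θ⌉₊ + 1 : ℕ) : ℝ)
          + 2 / ((min 1 ((γA - Jc) / (4 * (V * M + M₂ * V₄) + 1))) ^ (d + 1) * Real.sqrt γA)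
          + ((min 1 ((γA - Jc) / (4 * (V * M + M₂ * V₄) + 1))) ^ (d + 1))⁻¹ + 1)
        (16 * (M₂ * V₄) / (θ * (γA - Jc)) + 1) ∧
      ∀ (t D : ℕ) (κ : ℝ), 0 < κ →
      ∃ S ρ₁ ρ₂ ρ₃ ρ₄ : ℝ, 0 ≤ S ∧ 0 ≤ ρ₁ ∧ 0 ≤ ρ₂ ∧ 0 < ρ₃ ∧ 0 ≤ ρ₄ ∧
        ∀ {Λ : Finset (B1Eq324BenfattoLemma.Site d)} {A : Matrix Λ Λ ℝ} {K : B1Eq324BenfattoLemma.Site d → B1Eq324BenfattoLemma.Site d → ℝ},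
          (∀ x y, K x y = if h : x ∈ Λ ∧ y ∈ Λ then (A⁻¹ : Matrix Λ Λ ℝ) ⟨x, h.1⟩ ⟨y, h.2⟩ else 0) → Λ.Nonempty →
          (∀ e e', A e e' = A e' e) → (∀ x : Λ → ℝ, γA * ∑ e, x e ^ 2 ≤ ∑ e, ∑ e', A e e' * x e * x e') →
          (∀ e : Λ, ∑ e' : Λ, |A e e'| * (Real.cosh (θ * Real.sqrt (∑ j, ((((e : B1Eq324BenfattoLemma.Site d) j : ℝ) - ((e' : B1Eq324BenfattoLemma.Site d) j : ℝ))) ^ 2)) - 1) ≤ Jc) →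
          (∀ e : Λ, ∑ e' : Λ, Real.exp (-(θ * Real.sqrt (∑ j, ((((e : B1Eq324BenfattoLemma.Site d) j : ℝ) - ((e' : B1Eq324BenfattoLemma.Site d) j : ℝ))) ^ 2))) *
            (1 + Real.sqrt (∑ j, ((((e : B1Eq324BenfattoLemma.Site d) j : ℝ) - ((e' : B1Eq324BenfattoLemma.Site d) j : ℝ))) ^ 2)) ≤ V) →
          (∀ e : Λ, ∑ e' : Λ, |A e e'| * (1 + Real.sqrt (∑ j, ((((e : B1Eq324BenfattoLemma.Site d) j : ℝ) - ((e' : B1Eq324BenfattoLemma.Site d) j : ℝ))) ^ 2)) ≤ M) →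
          (∀ e : Λ, ∑ e' : Λ, Real.exp (-(θ / 2 * Real.sqrt (∑ j, ((((e : B1Eq324BenfattoLemma.Site d) j : ℝ) - ((e' : B1Eq324BenfattoLemma.Site d) j : ℝ))) ^ 2))) ≤ V₂) →
          (∀ e : Λ, ∑ e' : Λ, |A e e'| * Real.exp (θ / 2 * Real.sqrt (∑ j, ((((e : B1Eq324BenfattoLemma.Site d) j : ℝ) - ((e' : B1Eq324BenfattoLemma.Site d) j : ℝ))) ^ 2)) ≤ M₂) →
          (∀ e : Λ, ∑ e' : Λ, Real.exp (-(θ / 4 * Real.sqrt (∑ j, ((((e : B1Eq324BenfattoLemma.Site d) j : ℝ) - ((e' : B1Eq324BenfattoLemma.Site d) j : ℝ))) ^ 2))) *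
            (1 + Real.sqrt (∑ j, ((((e : B1Eq324BenfattoLemma.Site d) j : ℝ) - ((e' : B1Eq324BenfattoLemma.Site d) j : ℝ))) ^ 2)) ≤ V₄) →
          ∀ (s : ℕ) (b : ℝ), bstar < b → ∀ (I J : Finset (B1Eq324BenfattoLemma.Site d)), I.Nonempty → J ⊆ I →
            (∀ x ∈ J, ∀ z : B1Eq324BenfattoLemma.Site d, (∀ i, ((|z i - x i| : ℤ) : ℝ) ≤ b ^ 2) → z ∈ Λ) → ∀ a : Coef d,
            (∀ (C : Finset (B1Eq324BenfattoLemma.Site d)) (zbar : B1Eq324BenfattoLemma.Site d → ℝ), C ⊆ Λ →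
                (∀ c ∈ C, ∀ x ∈ J, b ^ 3 + Real.sqrt d * (b ^ 2 + 1) ≤ Real.sqrt (∑ j, (((x j : ℝ) - (c j : ℝ))) ^ 2)) →
                ∫ z, cutoffBoltzmann (hamiltonian s D κ a J) I b z ∂((gaussianFieldOfKernel (condCov K C)).map
                    fun (ζ' : B1Eq324BenfattoLemma.Site d → ℝ) (x : B1Eq324BenfattoLemma.Site d) => condMean K C zbar x + ζ' x) ≤
                  Real.exp (cumulantSum (gaussianFieldOfKernel K) (hamiltonian s D κ a J) t +
                    (I.card : ℝ) * errTerm S ρ₁ ρ₂ ρ₃ ρ₄ (coefSup s D a J) b t)) ∧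
            Real.exp (cumulantSum (gaussianFieldOfKernel K) (hamiltonian s D κ a J) t -
                  (I.card : ℝ) * errTerm S ρ₁ ρ₂ ρ₃ ρ₄ (coefSup s D a J) b t) ≤
                ∫ z, cutoffBoltzmann (hamiltonian s D κ a J) I b z ∂gaussianFieldOfKernel K := by
  refine ⟨_, le_rfl, fun t D κ hκ => ?_⟩
  obtain ⟨S, ρ₁, ρ₂, ρ₃, ρ₄, hS, hρ₁, hρ₂, hρ₃, -, hρ₄, hall⟩ :=
    classBasicLemma_signed_explicit hd hγA2 hJc0 hJcγ hθ hV0 hM0 hV₂0 hM₂0 hV₄0 t D κ hκ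
  exact ⟨S, ρ₁, ρ₂, ρ₃, ρ₄, hS, hρ₁, hρ₂, hρ₃, hρ₄, hall⟩

/-! ## §2  No pad: the class Basic Lemma (C = ∅ halves) for `μ_K` with `J ⊆ Λ` only, through seat n08-d's independent collar, explicit threshold -/

/-- ★★★ **THE CLASS BASIC LEMMA WITHOUT THE WINDOW PAD, KNIT FORM, EXPLICIT THRESHOLD** — the `hknit` input of the (α)-socket at EVERY run step
(`…RowClassSocketAllSteps.exists_h324Row_freeLetter_of_classSandwich_allSteps_of_forall_gt_ae`, seat n08-w4).  For `d ≥ 1`, class constants `γ_A ≥ 2`,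
`0 ≤ J_c < γ_A`, `θ > 0`, `V, M, V₂, M₂, V₄ ≥ 0` with the three GROWTH rows holding on every window (`hVu hV₂u hV₄u`, lattice sums — discharged for every `Λ` by
seat n08-d's `…ClassEntryRows.classRow_V_le / V₂ / V₄`), every `(t, D, ϰ > 0)` has ONE signed package `(S, ρ₁, ρ₂, ρ₃, ρ₄)` such that for every member
`(Λ, A, K)` (`Λ ≠ ∅`, `A` symmetric `γ_A`-coercive, rows `J_c, M, M₂`), every `s`, every
`b > max(B*(γ_A, J_c, θ, V, max M γ_A, max M₂ γ_A, V₄, d), 2/√γ_A, (2(D + 2d)/γ_A)²)` and every `(I, J, 𝔄)` with `∅ ≠ I ⊇ J`, `J ⊆ Λ` (NO pad):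
`exp(Σ_{k≤t}𝓔^T_K(H_J;k)/k! − |I|·errTerm S ρ… A b t) ≤ ∫Π_Δχ̂^I_b e^{H_J} dμ_K ≤ exp(Σ… + |I|·errTerm S ρ… A b t)`.  Proof: seat n08-d's collar of
`…KernelEq324.eq324_of_classSigned_noPad` in `b`-currency — pad `Λ` by `P = pad_{b²}(J) ∖ Λ`, `A′ = A ⊕ γ_A·1_P` (`…ClassCollar.symm_collar / coercive_collar /
row_collar_le`: a member with constants `(J_c, max M γ_A, max M₂ γ_A)` in which §1's pad holds), apply `classBasicLemma_signed_explicit` there at `C = ∅`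
(`…KernelCondField.condFieldK_empty`), transfer by `…ClassCollar.sandwich_of_collarMember_sandwich` (`S ↦ S + 4·8^d`; its thresholds `b² ≥ 4/γ_A`,
`ρ₃b^{3/2} ≤ γ_A b²/2` are the two extra members of the `max`, using §1's `ρ₃ ≤ D + 2d`).
[cite: BenfattoEtAl1978, Lemma p.152 (4.5)–(4.7) (on `ℤ^d`, no boundary), «b*» p.159, Appendix A p.161; Balaban1985BackgroundPropagators, Sect. E p.428 (class form; the collar is seat n08-d's, ours)] -/
theorem classBasicLemma_noPad_explicit (hd : 0 < d) {γA Jc θ V M V₂ M₂ V₄ : ℝ} (hγA2 : 2 ≤ γA) (hJc0 : 0 ≤ Jc) (hJcγ : Jc < γA) (hθ : 0 < θ)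
    (hV0 : 0 ≤ V) (hM0 : 0 ≤ M) (hV₂0 : 0 ≤ V₂) (hM₂0 : 0 ≤ M₂) (hV₄0 : 0 ≤ V₄)
    (hVu : ∀ (Λ₀ : Finset (B1Eq324BenfattoLemma.Site d)) (e : Λ₀), ∑ e' : Λ₀,
      Real.exp (-(θ * Real.sqrt (∑ j, ((((e : B1Eq324BenfattoLemma.Site d) j : ℝ) - ((e' : B1Eq324BenfattoLemma.Site d) j : ℝ))) ^ 2))) *
        (1 + Real.sqrt (∑ j, ((((e : B1Eq324BenfattoLemma.Site d) j : ℝ) - ((e' : B1Eq324BenfattoLemma.Site d) j : ℝ))) ^ 2)) ≤ V)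
    (hV₂u : ∀ (Λ₀ : Finset (B1Eq324BenfattoLemma.Site d)) (e : Λ₀), ∑ e' : Λ₀,
      Real.exp (-(θ / 2 * Real.sqrt (∑ j, ((((e : B1Eq324BenfattoLemma.Site d) j : ℝ) - ((e' : B1Eq324BenfattoLemma.Site d) j : ℝ))) ^ 2))) ≤ V₂)
    (hV₄u : ∀ (Λ₀ : Finset (B1Eq324BenfattoLemma.Site d)) (e : Λ₀), ∑ e' : Λ₀,
      Real.exp (-(θ / 4 * Real.sqrt (∑ j, ((((e : B1Eq324BenfattoLemma.Site d) j : ℝ) - ((e' : B1Eq324BenfattoLemma.Site d) j : ℝ))) ^ 2))) *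
        (1 + Real.sqrt (∑ j, ((((e : B1Eq324BenfattoLemma.Site d) j : ℝ) - ((e' : B1Eq324BenfattoLemma.Site d) j : ℝ))) ^ 2)) ≤ V₄) :
    ∀ (t D : ℕ) (κ : ℝ), 0 < κ →
      ∃ S ρ₁ ρ₂ ρ₃ ρ₄ : ℝ, 0 ≤ S ∧ 0 ≤ ρ₁ ∧ 0 ≤ ρ₂ ∧ 0 < ρ₃ ∧ 0 ≤ ρ₄ ∧
        ∀ {Λ : Finset (B1Eq324BenfattoLemma.Site d)} {A : Matrix Λ Λ ℝ} {K : B1Eq324BenfattoLemma.Site d → B1Eq324BenfattoLemma.Site d → ℝ},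
          (∀ x y, K x y = if h : x ∈ Λ ∧ y ∈ Λ then (A⁻¹ : Matrix Λ Λ ℝ) ⟨x, h.1⟩ ⟨y, h.2⟩ else 0) → Λ.Nonempty →
          (∀ e e', A e e' = A e' e) → (∀ x : Λ → ℝ, γA * ∑ e, x e ^ 2 ≤ ∑ e, ∑ e', A e e' * x e * x e') →
          (∀ e : Λ, ∑ e' : Λ, |A e e'| * (Real.cosh (θ * Real.sqrt (∑ j, ((((e : B1Eq324BenfattoLemma.Site d) j : ℝ) - ((e' : B1Eq324BenfattoLemma.Site d) j : ℝ))) ^ 2)) - 1) ≤ Jc) →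
          (∀ e : Λ, ∑ e' : Λ, |A e e'| * (1 + Real.sqrt (∑ j, ((((e : B1Eq324BenfattoLemma.Site d) j : ℝ) - ((e' : B1Eq324BenfattoLemma.Site d) j : ℝ))) ^ 2)) ≤ M) →
          (∀ e : Λ, ∑ e' : Λ, |A e e'| * Real.exp (θ / 2 * Real.sqrt (∑ j, ((((e : B1Eq324BenfattoLemma.Site d) j : ℝ) - ((e' : B1Eq324BenfattoLemma.Site d) j : ℝ))) ^ 2)) ≤ M₂) →
          ∀ (s : ℕ) (b : ℝ),
            max (max (6 * 2 ^ d * ((d + 1).factorial : ℝ) * (4 / ((min 1 ((γA - Jc) / (4 * (V * max M γA + max M₂ γA * V₄) + 1))) ^ d) ^ 2) ^ (d + 1)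
                  + 10 * (d + 1) * ((⌈1 / (2 * θ) + Real.sqrt (Jc / γA) / θ⌉₊ + 1 : ℕ) : ℝ)
                  + 2 / ((min 1 ((γA - Jc) / (4 * (V * max M γA + max M₂ γA * V₄) + 1))) ^ (d + 1) * Real.sqrt γA)
                  + ((min 1 ((γA - Jc) / (4 * (V * max M γA + max M₂ γA * V₄) + 1))) ^ (d + 1))⁻¹ + 1)
                (16 * (max M₂ γA * V₄) / (θ * (γA - Jc)) + 1))
              (max (2 / Real.sqrt γA) ((2 * ((D : ℝ) + 2 * d) / γA) ^ 2)) < b →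
            ∀ (I J : Finset (B1Eq324BenfattoLemma.Site d)) (a : Coef d), I.Nonempty → J ⊆ I → J ⊆ Λ →
              Real.exp (cumulantSum (gaussianFieldOfKernel K) (hamiltonian s D κ a J) t -
                    (I.card : ℝ) * errTerm S ρ₁ ρ₂ ρ₃ ρ₄ (coefSup s D a J) b t) ≤
                  ∫ z, cutoffBoltzmann (hamiltonian s D κ a J) I b z ∂gaussianFieldOfKernel K ∧
                ∫ z, cutoffBoltzmann (hamiltonian s D κ a J) I b z ∂gaussianFieldOfKernel K ≤
                  Real.exp (cumulantSum (gaussianFieldOfKernel K) (hamiltonian s D κ a J) t +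
                    (I.card : ℝ) * errTerm S ρ₁ ρ₂ ρ₃ ρ₄ (coefSup s D a J) b t) := by
  classical
  intro t D κ hκ
  have hγA0 : 0 < γA := by linarith
  obtain ⟨S, ρ₁, ρ₂, ρ₃, ρ₄, hS, hρ₁, hρ₂, hρ₃, hρ₃le, hρ₄, hall⟩ :=
    classBasicLemma_signed_explicit hd hγA2 hJc0 hJcγ hθ hV0 (le_max_of_le_left hM0) hV₂0 (le_max_of_le_left hM₂0) hV₄0 t D κ hκ
  refine ⟨S + 4 * 8 ^ d, ρ₁, ρ₂, ρ₃, ρ₄, by positivity, hρ₁, hρ₂, hρ₃, hρ₄, ?_⟩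
  intro Λ A K hK hΛne hAs hγA hJc hM hM₂ s b hb I J a hI hJI hJΛ
  -- the three thresholds
  have hbstar := lt_of_le_of_lt (le_max_left _ _) hb
  have hb2 : 2 / Real.sqrt γA < b := lt_of_le_of_lt ((le_max_left _ _).trans (le_max_right _ _)) hb
  have hb3 : (2 * ((D : ℝ) + 2 * d) / γA) ^ 2 < b := lt_of_le_of_lt ((le_max_right _ _).trans (le_max_right _ _)) hb
  have hsq0 : 0 < Real.sqrt γA := Real.sqrt_pos.mpr hγA0
  have h2s : 0 < 2 / Real.sqrt γA := by positivity
  have hbpos : 0 < b := lt_trans h2s hb2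
  have hbc : 4 * γA⁻¹ ≤ b ^ 2 := by
    have h2 : (2 / Real.sqrt γA) ^ 2 = 4 * γA⁻¹ := by
      rw [div_pow, Real.sq_sqrt hγA0.le]; ring
    rw [← h2]
    exact pow_le_pow_left₀ h2s.le hb2.le 2
  have hbig : ρ₃ * b ^ (3 / 2 : ℝ) ≤ b ^ 2 / (2 * γA⁻¹) := by
    have hq0 : 0 ≤ 2 * ((D : ℝ) + 2 * d) / γA := by positivity
    have hq : 2 * ((D : ℝ) + 2 * d) / γA ≤ Real.sqrt b := (Real.le_sqrt hq0 hbpos.le).mpr hb3.le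
    have hb32 : 0 ≤ b ^ (3 / 2 : ℝ) := Real.rpow_nonneg hbpos.le _
    have hsplit : b ^ 2 = b ^ (3 / 2 : ℝ) * Real.sqrt b := by
      rw [Real.sqrt_eq_rpow, ← Real.rpow_add hbpos]
      norm_num
    have h1 : ρ₃ * b ^ (3 / 2 : ℝ) ≤ ((D : ℝ) + 2 * d) * b ^ (3 / 2 : ℝ) := mul_le_mul_of_nonneg_right hρ₃le hb32
    have h2 : ((D : ℝ) + 2 * d) * b ^ (3 / 2 : ℝ) * (2 / γA) ≤ b ^ (3 / 2 : ℝ) * Real.sqrt b := by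
      have := mul_le_mul_of_nonneg_left hq hb32
      calc ((D : ℝ) + 2 * d) * b ^ (3 / 2 : ℝ) * (2 / γA) = b ^ (3 / 2 : ℝ) * (2 * ((D : ℝ) + 2 * d) / γA) := by ring
        _ ≤ b ^ (3 / 2 : ℝ) * Real.sqrt b := this
    have h3 : b ^ 2 / (2 * γA⁻¹) = (b ^ (3 / 2 : ℝ) * Real.sqrt b) * (γA / 2) := by
      rw [← hsplit]; field_simp
    rw [h3]
    have h4 : ((D : ℝ) + 2 * d) * b ^ (3 / 2 : ℝ) ≤ (b ^ (3 / 2 : ℝ) * Real.sqrt b) * (γA / 2) := by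
      have := mul_le_mul_of_nonneg_right h2 (by positivity : (0 : ℝ) ≤ γA / 2)
      calc ((D : ℝ) + 2 * d) * b ^ (3 / 2 : ℝ) = ((D : ℝ) + 2 * d) * b ^ (3 / 2 : ℝ) * (2 / γA) * (γA / 2) := by
            field_simp
        _ ≤ (b ^ (3 / 2 : ℝ) * Real.sqrt b) * (γA / 2) := this
    exact h1.trans h4
  -- THE COLLAR (seat n08-d's construction): pad, region, member
  set R : ℤ := ⌊b ^ 2⌋ with hR
  set pad : Finset (B1Eq324BenfattoLemma.Site d) :=
    J.biUnion fun x => Fintype.piFinset fun i => Finset.Icc (x i - R) (x i + R) with hpad_def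
  set Λ' : Finset (B1Eq324BenfattoLemma.Site d) := Λ ∪ (pad \ Λ) with hΛ'
  have hΛ : Λ ⊆ Λ' := Finset.subset_union_left
  set A' : Matrix Λ' Λ' ℝ := Matrix.of fun e e' =>
    if h : (e : B1Eq324BenfattoLemma.Site d) ∈ Λ ∧ (e' : B1Eq324BenfattoLemma.Site d) ∈ Λ then A ⟨e, h.1⟩ ⟨e', h.2⟩
    else if e = e' then γA else 0 with hA'
  have hAA : ∀ (e e' : Λ') (he : (e : B1Eq324BenfattoLemma.Site d) ∈ Λ) (he' : (e' : B1Eq324BenfattoLemma.Site d) ∈ Λ),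
      A' e e' = A ⟨e, he⟩ ⟨e', he'⟩ := fun e e' he he' => by
    rw [hA', Matrix.of_apply, dif_pos ⟨he, he'⟩]
  have hcross₁ : ∀ e e' : Λ', (e : B1Eq324BenfattoLemma.Site d) ∈ Λ → (e' : B1Eq324BenfattoLemma.Site d) ∉ Λ → A' e e' = 0 :=
    fun e e' he he' => by
      have hne : e ≠ e' := fun h => he' (h ▸ he)
      rw [hA', Matrix.of_apply, dif_neg (fun h => he' h.2), if_neg hne]
  have hcross₂ : ∀ e e' : Λ', (e : B1Eq324BenfattoLemma.Site d) ∉ Λ → (e' : B1Eq324BenfattoLemma.Site d) ∈ Λ → A' e e' = 0 :=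
    fun e e' he he' => by
      have hne : e ≠ e' := fun h => he (h ▸ he')
      rw [hA', Matrix.of_apply, dif_neg (fun h => he h.1), if_neg hne]
  have hdiag : ∀ e e' : Λ', (e : B1Eq324BenfattoLemma.Site d) ∉ Λ → (e' : B1Eq324BenfattoLemma.Site d) ∉ Λ →
      A' e e' = if e = e' then γA else 0 := fun e e' he _ => by
    rw [hA', Matrix.of_apply, dif_neg (fun h => he h.1)]
  -- the collar member's rows
  have hAs' := symm_collar (c := γA) hAs hAA hcross₁ hcross₂ hdiag
  have hγA' := coercive_collar hΛ hγA le_rfl hAA hcross₁ hcross₂ hdiag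
  have hApd : A.PosDef := posDef_of_coercive hAs hγA0 hγA
  have hA'pd : A'.PosDef := posDef_of_coercive hAs' hγA0 hγA'
  have hJc' : ∀ e : Λ', ∑ e' : Λ', |A' e e'| *
      (Real.cosh (θ * Real.sqrt (∑ j, ((((e : B1Eq324BenfattoLemma.Site d) j : ℝ) - ((e' : B1Eq324BenfattoLemma.Site d) j : ℝ))) ^ 2)) - 1) ≤ Jc := by
    intro e
    have h := row_collar_le hΛ
      (fun x y : B1Eq324BenfattoLemma.Site d => Real.cosh (θ * Real.sqrt (∑ j, (((x j : ℝ) - (y j : ℝ))) ^ 2)) - 1) (R := Jc) (w₀ := 0)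
      hJc (fun e _ => by simp) hAA hcross₁ hcross₂ hdiag e
    rwa [mul_zero, max_eq_left hJc0] at h
  have hM' : ∀ e : Λ', ∑ e' : Λ', |A' e e'| *
      (1 + Real.sqrt (∑ j, ((((e : B1Eq324BenfattoLemma.Site d) j : ℝ) - ((e' : B1Eq324BenfattoLemma.Site d) j : ℝ))) ^ 2)) ≤ max M γA := by
    intro e
    have h := row_collar_le hΛ
      (fun x y : B1Eq324BenfattoLemma.Site d => 1 + Real.sqrt (∑ j, (((x j : ℝ) - (y j : ℝ))) ^ 2)) (R := M) (w₀ := 1)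
      hM (fun e _ => by simp) hAA hcross₁ hcross₂ hdiag e
    rwa [mul_one, abs_of_pos hγA0] at h
  have hM₂' : ∀ e : Λ', ∑ e' : Λ', |A' e e'| *
      Real.exp (θ / 2 * Real.sqrt (∑ j, ((((e : B1Eq324BenfattoLemma.Site d) j : ℝ) - ((e' : B1Eq324BenfattoLemma.Site d) j : ℝ))) ^ 2)) ≤ max M₂ γA := by
    intro e
    have h := row_collar_le hΛ
      (fun x y : B1Eq324BenfattoLemma.Site d => Real.exp (θ / 2 * Real.sqrt (∑ j, (((x j : ℝ) - (y j : ℝ))) ^ 2))) (R := M₂) (w₀ := 1)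
      hM₂ (fun e _ => by simp) hAA hcross₁ hcross₂ hdiag e
    rwa [mul_one, abs_of_pos hγA0] at h
  -- §1's pad holds in `Λ'`
  have hpad' : ∀ x ∈ J, ∀ z : B1Eq324BenfattoLemma.Site d, (∀ i, ((|z i - x i| : ℤ) : ℝ) ≤ b ^ 2) → z ∈ Λ' := by
    intro x hx z hz
    have hzpad : z ∈ pad := by
      rw [hpad_def, Finset.mem_biUnion]
      refine ⟨x, hx, Fintype.mem_piFinset.mpr fun i => Finset.mem_Icc.mpr ?_⟩
      have hi : |z i - x i| ≤ R := Int.le_floor.mpr (hz i)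
      constructor <;> linarith [(abs_le.mp hi).1, (abs_le.mp hi).2]
    rw [hΛ', Finset.mem_union, Finset.mem_sdiff]
    by_cases hzΛ : z ∈ Λ
    · exact Or.inl hzΛ
    · exact Or.inr ⟨hzpad, hzΛ⟩
  -- §1 for the collar member at `C = ∅`
  set K' : B1Eq324BenfattoLemma.Site d → B1Eq324BenfattoLemma.Site d → ℝ := fun x y =>
    if h : x ∈ Λ' ∧ y ∈ Λ' then (A'⁻¹ : Matrix Λ' Λ' ℝ) ⟨x, h.1⟩ ⟨y, h.2⟩ else 0 with hK'def
  have hK' : ∀ x y, K' x y = if h : x ∈ Λ' ∧ y ∈ Λ' then (A'⁻¹ : Matrix Λ' Λ' ℝ) ⟨x, h.1⟩ ⟨y, h.2⟩ else 0 := fun _ _ => rfl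
  obtain ⟨h46, h47⟩ := hall hK' (hΛne.mono hΛ) hAs' hγA' hJc' (fun e => hVu Λ' e) hM' (fun e => hV₂u Λ' e) hM₂' (fun e => hV₄u Λ' e)
    s b hbstar I J hI hJI hpad' a
  have hup' := h46 ∅ (fun _ => 0) (Finset.empty_subset _) (fun c hc => absurd hc (Finset.notMem_empty _))
  rw [condFieldK_empty] at hup'
  -- transfer to `μ_K` in print's currency (`S ↦ S + 4·8^d`)
  exact sandwich_of_collarMember_sandwich hΛ hγA0 hApd hA'pd hAA hcross₁ hcross₂ hdiag hK hK' a hJΛ hI hbpos hbc t hρ₄ hbig h47 hup'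

/-! ## §3  The growth rows discharged on the lattice (`…ClassEntryRows`): the member carries only symmetry, coercivity and the rows `J_c, M, M₂` -/

/-- ★★★ **NO PAD, GROWTH ROWS DISCHARGED**: §2 with the three lattice growth rows supplied by seat n08-d's `…ClassEntryRows.classRow_V_le / V₂ / V₄`
(`V = (1 + 2/θ)K_d(θ/2)`, `V₂ = K_d(θ/2)`, `V₄ = (1 + 8/θ)K_d(θ/8)`, `K_d(c) = (2e^{c/√d}/(1 − e^{−c/√d}))^d`) — the member `(Λ, A, K)` carries ONLY `hK`, `Λ ≠ ∅`,
symmetry, `γ_A`-coercivity (`γ_A ≥ 2`) and the rows `J_c, M, M₂`, exactly as in `…KernelEq324.eq324_kernel_noPad`; the threshold is the §2 formula at those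
`V, V₄` (a function of `(γ_A, J_c, θ, M, M₂, d, D)` alone).  [cite: BenfattoEtAl1978, Lemma p.152 (4.5)–(4.7), «b*» p.159, Appendix C (C.1) p.164;
Balaban1985BackgroundPropagators, Sect. E p.428 (class form; ours)] -/
theorem classBasicLemma_kernel_noPad (hd : 0 < d) {γA Jc θ M M₂ : ℝ} (hγA2 : 2 ≤ γA) (hJc0 : 0 ≤ Jc) (hJcγ : Jc < γA) (hθ : 0 < θ)
    (hM0 : 0 ≤ M) (hM₂0 : 0 ≤ M₂) :
    ∀ (t D : ℕ) (κ : ℝ), 0 < κ →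
      ∃ S ρ₁ ρ₂ ρ₃ ρ₄ : ℝ, 0 ≤ S ∧ 0 ≤ ρ₁ ∧ 0 ≤ ρ₂ ∧ 0 < ρ₃ ∧ 0 ≤ ρ₄ ∧
        ∀ {Λ : Finset (B1Eq324BenfattoLemma.Site d)} {A : Matrix Λ Λ ℝ} {K : B1Eq324BenfattoLemma.Site d → B1Eq324BenfattoLemma.Site d → ℝ},
          (∀ x y, K x y = if h : x ∈ Λ ∧ y ∈ Λ then (A⁻¹ : Matrix Λ Λ ℝ) ⟨x, h.1⟩ ⟨y, h.2⟩ else 0) → Λ.Nonempty →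
          (∀ e e', A e e' = A e' e) → (∀ x : Λ → ℝ, γA * ∑ e, x e ^ 2 ≤ ∑ e, ∑ e', A e e' * x e * x e') →
          (∀ e : Λ, ∑ e' : Λ, |A e e'| * (Real.cosh (θ * Real.sqrt (∑ j, ((((e : B1Eq324BenfattoLemma.Site d) j : ℝ) - ((e' : B1Eq324BenfattoLemma.Site d) j : ℝ))) ^ 2)) - 1) ≤ Jc) →
          (∀ e : Λ, ∑ e' : Λ, |A e e'| * (1 + Real.sqrt (∑ j, ((((e : B1Eq324BenfattoLemma.Site d) j : ℝ) - ((e' : B1Eq324BenfattoLemma.Site d) j : ℝ))) ^ 2)) ≤ M) →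
          (∀ e : Λ, ∑ e' : Λ, |A e e'| * Real.exp (θ / 2 * Real.sqrt (∑ j, ((((e : B1Eq324BenfattoLemma.Site d) j : ℝ) - ((e' : B1Eq324BenfattoLemma.Site d) j : ℝ))) ^ 2)) ≤ M₂) →
          ∀ (s : ℕ) (b : ℝ),
            max (max (6 * 2 ^ d * ((d + 1).factorial : ℝ) * (4 / ((min 1 ((γA - Jc) / (4 * (((1 + 2 / θ) * (2 / (1 - Real.exp (-(θ / 2 / Real.sqrt d))) * Real.exp (θ / 2 / Real.sqrt d)) ^ d) * max M γA + max M₂ γA * ((1 + 8 / θ) * (2 / (1 - Real.exp (-(θ / 8 / Real.sqrt d))) * Real.exp (θ / 8 / Real.sqrt d)) ^ d)) + 1))) ^ d) ^ 2) ^ (d + 1)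
                  + 10 * (d + 1) * ((⌈1 / (2 * θ) + Real.sqrt (Jc / γA) / θ⌉₊ + 1 : ℕ) : ℝ)
                  + 2 / ((min 1 ((γA - Jc) / (4 * (((1 + 2 / θ) * (2 / (1 - Real.exp (-(θ / 2 / Real.sqrt d))) * Real.exp (θ / 2 / Real.sqrt d)) ^ d) * max M γA + max M₂ γA * ((1 + 8 / θ) * (2 / (1 - Real.exp (-(θ / 8 / Real.sqrt d))) * Real.exp (θ / 8 / Real.sqrt d)) ^ d)) + 1))) ^ (d + 1) * Real.sqrt γA)
                  + ((min 1 ((γA - Jc) / (4 * (((1 + 2 / θ) * (2 / (1 - Real.exp (-(θ / 2 / Real.sqrt d))) * Real.exp (θ / 2 / Real.sqrt d)) ^ d) * max M γA + max M₂ γA * ((1 + 8 / θ) * (2 / (1 - Real.exp (-(θ / 8 / Real.sqrt d))) * Real.exp (θ / 8 / Real.sqrt d)) ^ d)) + 1))) ^ (d + 1))⁻¹ + 1)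
                (16 * (max M₂ γA * ((1 + 8 / θ) * (2 / (1 - Real.exp (-(θ / 8 / Real.sqrt d))) * Real.exp (θ / 8 / Real.sqrt d)) ^ d)) / (θ * (γA - Jc)) + 1))
              (max (2 / Real.sqrt γA) ((2 * ((D : ℝ) + 2 * d) / γA) ^ 2)) < b →
            ∀ (I J : Finset (B1Eq324BenfattoLemma.Site d)) (a : Coef d), I.Nonempty → J ⊆ I → J ⊆ Λ →
              Real.exp (cumulantSum (gaussianFieldOfKernel K) (hamiltonian s D κ a J) t -
                    (I.card : ℝ) * errTerm S ρ₁ ρ₂ ρ₃ ρ₄ (coefSup s D a J) b t) ≤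
                  ∫ z, cutoffBoltzmann (hamiltonian s D κ a J) I b z ∂gaussianFieldOfKernel K ∧
                ∫ z, cutoffBoltzmann (hamiltonian s D κ a J) I b z ∂gaussianFieldOfKernel K ≤
                  Real.exp (cumulantSum (gaussianFieldOfKernel K) (hamiltonian s D κ a J) t +
                    (I.card : ℝ) * errTerm S ρ₁ ρ₂ ρ₃ ρ₄ (coefSup s D a J) b t) := by
  classical
  -- the lattice growth constants are non-negative: each dominates a row at the one-site window `{0}`
  have hone : ((0 : B1Eq324BenfattoLemma.Site d)) ∈ ({0} : Finset (B1Eq324BenfattoLemma.Site d)) := Finset.mem_singleton_self _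
  have hrow_nonneg : ∀ (w : B1Eq324BenfattoLemma.Site d → B1Eq324BenfattoLemma.Site d → ℝ), (∀ x y, 0 ≤ w x y) →
      ∀ {B : ℝ}, (∑ e' : ({0} : Finset (B1Eq324BenfattoLemma.Site d)), w (0 : B1Eq324BenfattoLemma.Site d) e' ≤ B) → 0 ≤ B :=
    fun w hw B hB => le_trans (Finset.sum_nonneg fun e' _ => hw _ _) hB
  have hV0 := hrow_nonneg (fun x y => Real.exp (-(θ * Real.sqrt (∑ j, (((x j : ℝ) - (y j : ℝ))) ^ 2))) *
      (1 + Real.sqrt (∑ j, (((x j : ℝ) - (y j : ℝ))) ^ 2))) (fun x y => by positivity) (classRow_V_le hθ ⟨0, hone⟩)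
  have hV₂0 := hrow_nonneg (fun x y => Real.exp (-(θ / 2 * Real.sqrt (∑ j, (((x j : ℝ) - (y j : ℝ))) ^ 2)))) (fun x y => by positivity)
    (classRow_V₂_le hθ ⟨0, hone⟩)
  have hV₄0 := hrow_nonneg (fun x y => Real.exp (-(θ / 4 * Real.sqrt (∑ j, (((x j : ℝ) - (y j : ℝ))) ^ 2))) *
      (1 + Real.sqrt (∑ j, (((x j : ℝ) - (y j : ℝ))) ^ 2))) (fun x y => by positivity) (classRow_V₄_le hθ ⟨0, hone⟩)
  exact classBasicLemma_noPad_explicit hd hγA2 hJc0 hJcγ hθ hV0 hM0 hV₂0 hM₂0 hV₄0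
    (fun Λ₀ e => classRow_V_le hθ e) (fun Λ₀ e => classRow_V₂_le hθ e) (fun Λ₀ e => classRow_V₄_le hθ e)

end Literature.MathematicalPhysics.QuantumFieldTheory.Balaban1983to89.B1Eq324BenfattoKernelSect5ClassBasicLemmaExplicit
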